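import Literature.NumberTheory.NumberFields.SqrtTwoTowerThreeGaloisAction
import Literature.NumberTheory.IwasawaTheory.CyclotomicTwoLayerThreeNonNormUnit
import Literature.NumberTheory.IwasawaTheory.ClassGroupPRankLeOfRelationTwoAnyDepth
import HarnessLib

/-!
# `μ₂ = 0`, `λ₂ ≤ d` FROM AN ARBITRARY RELATION ROW AT LAYER THREE: the t-free relation door of the cyclotomic `ℤ₂`-tower fed by
# COORDINATES — the class `c = [(q₀, s₃ − t)] ∈ Cl(K_3)`, the generator `σ : s₃ ↦ s₃³ − 3s₃`, ANY exponent vector `(e₀, …, e₇)` with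
# `Σ eᵢ Xⁱ = (X−1)^d·u + 2g`, `d ≤ 6`, and ONE element `y` with `y ∈ σ^i(𝔮)^{eᵢ}` for every `i` (two-generator power memberships) and `N(y) = ε·q₀^{Σeᵢ}`

`Proofs`-style file (theorems only: no definition, no named fact, no instance, no `sorry`) in topic `NumberTheory/IwasawaTheory` (namespace = path),
written by the prover seat `bsd-line-att-p4` g43 (cell `bsd-f1-sign2`, route `AlignedTransportAtTwo`; `--supports` stmt-BirchSwinnertonDyer-22298, closes nothing).
GENERALISES this seat's `classicalMuVanishes_two_of_relationCert_layer_three` (`ClassicalMuVanishesLayerThreeRelationCertificateTwo`, the shape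
`f = 1 + X + X⁴ + X⁵` only) to EVERY relation shape the door of att-p3 g49 (`classicalMuVanishes_two_of_relation_of_genusCert_layer_anyDepth`) accepts at
`m = 3`: `∏_{i<8} σ^i(c)^{eᵢ} = 1` with `Σ eᵢ Xⁱ = (X − 1)^d u + 2 g`, `u(1)` odd, `d + 2 ≤ 8`.  No two-generator PRODUCT calculus is needed any more: the
principal generator `y` of `𝔄 = ∏ σ^i(𝔮)^{eᵢ}` (`𝔮 = (q₀, s₃ − t)`) is certified by MEMBERSHIPS `y = Σ_k c_{i,k} q₀^{eᵢ−k} (σ^i s₃ − t)^k` (so `y ∈ σ^i(𝔮)^{eᵢ}`),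
by the pairwise COPRIMALITY of the eight conjugates `σ^i 𝔮` (seven Bézout identities `α_k q₀ + v_k p_k(t) = 1` in `𝓞_K`, `p_k(t) = (σ^k s₃)(t) − t` the
integer polynomials `t³ − 4t`, `−t⁷ + 7t⁵ − 14t³ + 6t`, `t⁵ − 5t³ + 4t`, `−2t`, `−t³ + 2t`, `t⁷ − 7t⁵ + 14t³ − 8t`, `−t⁵ + 5t³ − 6t`), which turns the
memberships into `y ∈ ⋂ σ^i(𝔮)^{eᵢ} = 𝔄`, and by the NORM `N_{K_3/K}(y) = ε q₀^{Σ eᵢ} = N(𝔄)` (so `(y) = 𝔄` by cancellation in the Dedekind domain `𝓞_{K_3}`).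

* ★★★ `classicalMuVanishes_two_of_generalRelationCert_layer_three` — `K` odd degree, `2 ∤ d_K`, `κ` cyclotomic, two dyadic primes, `2 ∤ h_K`, `𝓞_K/𝔭₁ = 𝔽₂`,
  units `≡ ±1 (mod 𝔭₁³)`; DATA: `q₀` (`(q₀)` maximal, `q₀ ≡ ±3 (mod 𝔭₁³)`), `t ∈ ℤ`, `ψ : 𝓞_K → ℤ/q` (`ψ q₀ = 0`, `P(t) = 0`), `α q₀⁸ + β P(t) = q₀`, the seven
  coprimality witnesses, exponents `e₀ … e₇` with `Σ eᵢ = n` and the polynomial identity, `y` (eight coordinates) with the eight membership certificates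
  (universally quantified over commutative rings — a row discharges each by one `linear_combination`), the tower-norm templates and `V₀² − 2V₁² = ε q₀ⁿ`
  ⟹ **`rank₂ Cl(K_l) ≤ d ∀ l`, `μ₂(κ) = 0`, `λ₂(κ) ≤ d`**.
* `sum_mul_pow_mul_pow_mem_span_pair_pow` (`Σ_k c_k b^{n−k} z^k ∈ (b, z)ⁿ`), `span_pair_sup_span_pair_eq_top_of_comax` (`a b + c z + d z' = 1 ⟹ (b,z) + (b,z') = (1)`).

CELL READING (crux C2): the seeds 1187 / 14539 (converse quadrant) have NO relation of nilpotency `d ≤ 2` at layer two (this seat's generator search), and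
14891 / 3523 need squares of conjugate primes at layer three; this door consumes whatever relation `Cl(K_3)` has (`3 ≤ d ≤ 6` included) from ONE generator `y`.
HONEST SCOPE: classical; nothing about any summit is asserted here; BSD is not advanced.

References: [Washington1997] §13.1, §13.3 Prop. 13.22–13.23; [Lang1990] Ch. 13 §4 Lemma 4.1; [Fukuda1994] Thm. 1; [Gras2003] IV.4; [NeukirchANT1999] Ch. I §3
(3.1)–(3.3) (unique factorisation, coprime ideals, cancellation), §8, Ch. III (1.6)–(1.7); [Cohen1993] §4.7, §6.5.
-/

set_option autoImplicit false

noncomputable section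

open scoped NumberField nonZeroDivisors
open NumberField IsDedekindDomain Module Polynomial Finset

namespace Literature.NumberTheory.IwasawaTheory

open Literature.NumberTheory.EllipticCurves Literature.NumberTheory.NumberFields Literature.NumberTheory.NumberFields.AmbiguousClass

/-! ## §0 Two pieces of ideal algebra -/

section Algebra

variable {R : Type*} [CommRing R]

/-- `Σ_{k ≤ n} c_k b^{n−k} z^k ∈ (b, z)ⁿ`: every monomial `b^{n−k} z^k` lies in `(b,z)^{n−k}·(b,z)^k = (b,z)ⁿ`. [cite: NeukirchANT1999, Ch. I §3 (3.1)–(3.3)]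
[cite: Cohen1993, §4.7] -/
theorem sum_mul_pow_mul_pow_mem_span_pair_pow (b z : R) (n : ℕ) (c : ℕ → R) :
    ∑ k ∈ Finset.range (n + 1), c k * b ^ (n - k) * z ^ k ∈ Ideal.span {b, z} ^ n := by
  refine Ideal.sum_mem _ fun k hk => ?_
  have hk' : k ≤ n := Nat.lt_succ_iff.mp (Finset.mem_range.mp hk)
  have hb : b ∈ Ideal.span {b, z} := Ideal.subset_span (by simp)
  have hz : z ∈ Ideal.span {b, z} := Ideal.subset_span (by simp)
  have h : b ^ (n - k) * z ^ k ∈ Ideal.span {b, z} ^ n := by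
    have h := Ideal.mul_mem_mul (Ideal.pow_mem_pow hb (n - k)) (Ideal.pow_mem_pow hz k)
    rwa [← pow_add, Nat.sub_add_cancel hk'] at h
  rw [mul_assoc]
  exact Ideal.mul_mem_left _ _ h

/-- `a b + c z + d z' = 1 ⟹ (b, z) + (b, z') = (1)`. [cite: NeukirchANT1999, Ch. I §3 (3.1)–(3.3)] [cite: Cohen1993, §4.7] -/
theorem span_pair_sup_span_pair_eq_top_of_comax {a b c d z z' : R} (h : a * b + c * z + d * z' = 1) :
    Ideal.span {b, z} ⊔ Ideal.span {b, z'} = ⊤ := by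
  rw [Ideal.eq_top_iff_one, ← h]
  refine Submodule.add_mem_sup (Ideal.mem_span_pair.mpr ⟨a, c, by ring⟩) ?_
  exact Ideal.mul_mem_left _ _ (Ideal.subset_span (by simp))

end Algebra

/-! ## §1 The general relation certificate at layer three -/

section Layer

variable {K : Type} [Field K] [NumberField K]

set_option maxHeartbeats 3200000 in
set_option synthInstance.maxHeartbeats 400000 in
/-- ★★★ **`μ₂ = 0`, `λ₂ ≤ d`, `rank₂ Cl(K_l) ≤ d ∀ l` FROM AN ARBITRARY LAYER-THREE RELATION ROW IN COORDINATES.**  `K` odd degree, `2 ∤ d_K`,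
`κ` cyclotomic, exactly two primes above `2`, `2 ∤ h_K`; `P ∋ 2` maximal with `𝓞_K/P = 𝔽₂`; all units `≡ ±1 (mod P³)`.  DATA: `q₀` with `(q₀)` maximal,
`q₀ ≡ ±3 (mod P³)`; `t ∈ ℤ`; `ψ : 𝓞_K → ℤ/q` (`1 < q`, `2` invertible), `ψ q₀ = 0`, `P(t) = 0`; `α q₀⁸ + β P(t) = q₀`; coprimality witnesses
`α_k q₀ + v_k p_k(t) = 1` (`k = 1…7`); exponents `e₀,…,e₇` (`Σ = n`) with `Σ eᵢ Xⁱ = (X−1)^d u + 2g`, `u(1)` odd, `d + 2 ≤ 8`; `y` (eight coordinates) with,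
for each `i < 8`, a membership certificate `y = Σ_{k ≤ eᵢ} c_k q₀^{eᵢ−k} (σ^i s₃ − t)^k` valid in every commutative ring with `S₁² = 2, S₂² = 2+S₁, S₃² = 2+S₂`;
tower-norm templates `U, V` and a unit `ε` with `V₀² − 2V₁² = ε q₀ⁿ`.  THEN `rank₂ Cl(K_l) ≤ d` for all `l`, `μ₂(κ) = 0`, `λ₂(κ) ≤ d`.
[cite: Washington1997, §13.3 Prop. 13.22–13.23] [cite: Lang1990, Ch. 13 §4 Lemma 4.1] [cite: NeukirchANT1999, Ch. III (1.6)–(1.7); Ch. I §3 (3.3)]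
[cite: Cohen1993, §4.7, §6.5] -/
theorem classicalMuVanishes_two_of_generalRelationCert_layer_three (hK2 : ¬ 2 ∣ Module.finrank ℚ K) (hd : ¬ (2 : ℤ) ∣ NumberField.discr K)
    (κ : ZpExtension K 2) (hκ : κ.IsCyclotomic)
    (h2card : {w : HeightOneSpectrum (𝓞 K) | ((2 : ℕ) : 𝓞 K) ∈ w.asIdeal}.ncard = 2)
    (hh : ¬ 2 ∣ classNumber K)
    (P : Ideal (𝓞 K)) [P.IsMaximal] (hres : ∀ r : 𝓞 K, r ∈ P ∨ r - 1 ∈ P) (h2P : (2 : 𝓞 K) ∈ P)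
    (hunits : ∀ u : (𝓞 K)ˣ, (u : 𝓞 K) - 1 ∈ P ^ 3 ∨ (u : 𝓞 K) + 1 ∈ P ^ 3)
    (q₀ : 𝓞 K) (hq₀ : (Ideal.span {q₀}).IsMaximal) (hπ : q₀ - 3 ∈ P ^ 3 ∨ q₀ + 3 ∈ P ^ 3)
    (t : ℤ) {q : ℕ} (hq : 1 < q) (ψ : 𝓞 K →+* ZMod q) (hψ : ψ q₀ = 0) {ti : ZMod q} (hti : 2 * ti = 1)
    (hPt : (((t : ZMod q) ^ 2 - 2) ^ 2 - 2) ^ 2 - 2 = 0)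
    (α β : 𝓞 K) (hBez : α * q₀ ^ 8 + β * ((((t : 𝓞 K) ^ 2 - 2) ^ 2 - 2) ^ 2 - 2) = q₀)
    (α₁ v₁ : 𝓞 K) (hC₁ : α₁ * q₀ + v₁ * ((-4) * (t : 𝓞 K) + (t : 𝓞 K) ^ 3) = 1)
    (α₂ v₂ : 𝓞 K) (hC₂ : α₂ * q₀ + v₂ * (6 * (t : 𝓞 K) + (-14) * (t : 𝓞 K) ^ 3 + 7 * (t : 𝓞 K) ^ 5 + (-1) * (t : 𝓞 K) ^ 7) = 1)
    (α₃ v₃ : 𝓞 K) (hC₃ : α₃ * q₀ + v₃ * (4 * (t : 𝓞 K) + (-5) * (t : 𝓞 K) ^ 3 + (t : 𝓞 K) ^ 5) = 1)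
    (α₄ v₄ : 𝓞 K) (hC₄ : α₄ * q₀ + v₄ * ((-2) * (t : 𝓞 K)) = 1)
    (α₅ v₅ : 𝓞 K) (hC₅ : α₅ * q₀ + v₅ * (2 * (t : 𝓞 K) + (-1) * (t : 𝓞 K) ^ 3) = 1)
    (α₆ v₆ : 𝓞 K) (hC₆ : α₆ * q₀ + v₆ * ((-8) * (t : 𝓞 K) + 14 * (t : 𝓞 K) ^ 3 + (-7) * (t : 𝓞 K) ^ 5 + (t : 𝓞 K) ^ 7) = 1)
    (α₇ v₇ : 𝓞 K) (hC₇ : α₇ * q₀ + v₇ * ((-6) * (t : 𝓞 K) + 5 * (t : 𝓞 K) ^ 3 + (-1) * (t : 𝓞 K) ^ 5) = 1)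
    (e₀ e₁ e₂ e₃ e₄ e₅ e₆ e₇ : ℕ) {n d : ℕ} (hn : e₀ + e₁ + e₂ + e₃ + e₄ + e₅ + e₆ + e₇ = n) (hd2 : d + 2 ≤ 8) {u g : ℤ[X]} (hu : ¬ (2 : ℤ) ∣ u.eval 1)
    (hF : (C (e₀ : ℤ) + C (e₁ : ℤ) * X + C (e₂ : ℤ) * X ^ 2 + C (e₃ : ℤ) * X ^ 3 + C (e₄ : ℤ) * X ^ 4 + C (e₅ : ℤ) * X ^ 5 + C (e₆ : ℤ) * X ^ 6 +
      C (e₇ : ℤ) * X ^ 7 : ℤ[X]) = (X - 1) ^ d * u + C (2 : ℤ) * g)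
    (y₀ y₁ y₂ y₃ y₄ y₅ y₆ y₇ : 𝓞 K)
    (hmem₀ : ∀ (R : Type) [CommRing R] (φ : 𝓞 K →+* R) (S₁ S₂ S₃ : R), S₁ ^ 2 = 2 → S₂ ^ 2 = 2 + S₁ → S₃ ^ 2 = 2 + S₂ →
      ∃ c : ℕ → R, φ y₀ + φ y₁ * S₁ + (φ y₂ + φ y₃ * S₁) * S₂ + (φ y₄ + φ y₅ * S₁ + (φ y₆ + φ y₇ * S₁) * S₂) * S₃ =
        ∑ k ∈ Finset.range (e₀ + 1), c k * φ q₀ ^ (e₀ - k) * (S₃ - (t : R)) ^ k)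
    (hmem₁ : ∀ (R : Type) [CommRing R] (φ : 𝓞 K →+* R) (S₁ S₂ S₃ : R), S₁ ^ 2 = 2 → S₂ ^ 2 = 2 + S₁ → S₃ ^ 2 = 2 + S₂ →
      ∃ c : ℕ → R, φ y₀ + φ y₁ * S₁ + (φ y₂ + φ y₃ * S₁) * S₂ + (φ y₄ + φ y₅ * S₁ + (φ y₆ + φ y₇ * S₁) * S₂) * S₃ =
        ∑ k ∈ Finset.range (e₁ + 1), c k * φ q₀ ^ (e₁ - k) * (S₂ * S₃ - S₃ - (t : R)) ^ k)
    (hmem₂ : ∀ (R : Type) [CommRing R] (φ : 𝓞 K →+* R) (S₁ S₂ S₃ : R), S₁ ^ 2 = 2 → S₂ ^ 2 = 2 + S₁ → S₃ ^ 2 = 2 + S₂ →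
      ∃ c : ℕ → R, φ y₀ + φ y₁ * S₁ + (φ y₂ + φ y₃ * S₁) * S₂ + (φ y₄ + φ y₅ * S₁ + (φ y₆ + φ y₇ * S₁) * S₂) * S₃ =
        ∑ k ∈ Finset.range (e₂ + 1), c k * φ q₀ ^ (e₂ - k) * (S₃ + S₁ * S₃ - S₁ * S₂ * S₃ - (t : R)) ^ k)
    (hmem₃ : ∀ (R : Type) [CommRing R] (φ : 𝓞 K →+* R) (S₁ S₂ S₃ : R), S₁ ^ 2 = 2 → S₂ ^ 2 = 2 + S₁ → S₃ ^ 2 = 2 + S₂ →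
      ∃ c : ℕ → R, φ y₀ + φ y₁ * S₁ + (φ y₂ + φ y₃ * S₁) * S₂ + (φ y₄ + φ y₅ * S₁ + (φ y₆ + φ y₇ * S₁) * S₂) * S₃ =
        ∑ k ∈ Finset.range (e₃ + 1), c k * φ q₀ ^ (e₃ - k) * (S₃ + S₁ * S₃ - S₂ * S₃ - (t : R)) ^ k)
    (hmem₄ : ∀ (R : Type) [CommRing R] (φ : 𝓞 K →+* R) (S₁ S₂ S₃ : R), S₁ ^ 2 = 2 → S₂ ^ 2 = 2 + S₁ → S₃ ^ 2 = 2 + S₂ →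
      ∃ c : ℕ → R, φ y₀ + φ y₁ * S₁ + (φ y₂ + φ y₃ * S₁) * S₂ + (φ y₄ + φ y₅ * S₁ + (φ y₆ + φ y₇ * S₁) * S₂) * S₃ =
        ∑ k ∈ Finset.range (e₄ + 1), c k * φ q₀ ^ (e₄ - k) * (-S₃ - (t : R)) ^ k)
    (hmem₅ : ∀ (R : Type) [CommRing R] (φ : 𝓞 K →+* R) (S₁ S₂ S₃ : R), S₁ ^ 2 = 2 → S₂ ^ 2 = 2 + S₁ → S₃ ^ 2 = 2 + S₂ →
      ∃ c : ℕ → R, φ y₀ + φ y₁ * S₁ + (φ y₂ + φ y₃ * S₁) * S₂ + (φ y₄ + φ y₅ * S₁ + (φ y₆ + φ y₇ * S₁) * S₂) * S₃ =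
        ∑ k ∈ Finset.range (e₅ + 1), c k * φ q₀ ^ (e₅ - k) * (S₃ - S₂ * S₃ - (t : R)) ^ k)
    (hmem₆ : ∀ (R : Type) [CommRing R] (φ : 𝓞 K →+* R) (S₁ S₂ S₃ : R), S₁ ^ 2 = 2 → S₂ ^ 2 = 2 + S₁ → S₃ ^ 2 = 2 + S₂ →
      ∃ c : ℕ → R, φ y₀ + φ y₁ * S₁ + (φ y₂ + φ y₃ * S₁) * S₂ + (φ y₄ + φ y₅ * S₁ + (φ y₆ + φ y₇ * S₁) * S₂) * S₃ =
        ∑ k ∈ Finset.range (e₆ + 1), c k * φ q₀ ^ (e₆ - k) * (-S₃ - S₁ * S₃ + S₁ * S₂ * S₃ - (t : R)) ^ k)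
    (hmem₇ : ∀ (R : Type) [CommRing R] (φ : 𝓞 K →+* R) (S₁ S₂ S₃ : R), S₁ ^ 2 = 2 → S₂ ^ 2 = 2 + S₁ → S₃ ^ 2 = 2 + S₂ →
      ∃ c : ℕ → R, φ y₀ + φ y₁ * S₁ + (φ y₂ + φ y₃ * S₁) * S₂ + (φ y₄ + φ y₅ * S₁ + (φ y₆ + φ y₇ * S₁) * S₂) * S₃ =
        ∑ k ∈ Finset.range (e₇ + 1), c k * φ q₀ ^ (e₇ - k) * (-S₃ - S₁ * S₃ + S₂ * S₃ - (t : R)) ^ k)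
    (U₀ U₁ U₂ U₃ V₀ V₁ : 𝓞 K)
    (hU₀ : U₀ = -8 * y₇ ^ 2 - 8 * y₆ * y₇ - 4 * y₆ ^ 2 - 8 * y₅ * y₇ - 4 * y₅ * y₆ - 4 * y₅ ^ 2 - 4 * y₄ * y₇ - 4 * y₄ * y₆ - 2 * y₄ ^ 2 + 4 * y₃ ^ 2 + 4 * y₂ * y₃ +
        2 * y₂ ^ 2 + 2 * y₁ ^ 2 + y₀ ^ 2)
    (hU₁ : U₁ = -4 * y₇ ^ 2 - 8 * y₆ * y₇ - 2 * y₆ ^ 2 - 4 * y₅ * y₇ - 4 * y₅ * y₆ - 4 * y₄ * y₇ - 2 * y₄ * y₆ - 4 * y₄ * y₅ + 2 * y₃ ^ 2 + 4 * y₂ * y₃ + y₂ ^ 2 +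
        2 * y₀ * y₁)
    (hU₂ : U₂ = -4 * y₇ ^ 2 - 4 * y₆ * y₇ - 2 * y₆ ^ 2 - 8 * y₅ * y₇ - 2 * y₅ ^ 2 - 4 * y₄ * y₆ - y₄ ^ 2 + 4 * y₁ * y₃ + 2 * y₀ * y₂)
    (hU₃ : U₃ = -2 * y₇ ^ 2 - 4 * y₆ * y₇ - y₆ ^ 2 - 4 * y₅ * y₆ - 4 * y₄ * y₇ - 2 * y₄ * y₅ + 2 * y₁ * y₂ + 2 * y₀ * y₃)
    (hV₀ : V₀ = -4 * U₃ ^ 2 - 4 * U₂ * U₃ - 2 * U₂ ^ 2 + 2 * U₁ ^ 2 + U₀ ^ 2) (hV₁ : V₁ = -2 * U₃ ^ 2 - 4 * U₂ * U₃ - U₂ ^ 2 + 2 * U₀ * U₁)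
    (ε : (𝓞 K)ˣ) (hN : V₀ ^ 2 - 2 * V₁ ^ 2 = ε * q₀ ^ n) :
    (∀ l, classGroupPRank κ l ≤ d) ∧ ClassicalMuVanishes κ ∧ classicalLambda κ ≤ d := by
  classical
  haveI : Fact (Nat.Prime 2) := ⟨Nat.prime_two⟩
  -- ### the layers `K₁ ⊂ K₂ ⊂ K₃`
  have h12 : κ.layer 1 ≤ κ.layer 2 := κ.layer_mono one_le_two
  have h23 : κ.layer 2 ≤ κ.layer 3 := κ.layer_mono (by norm_num)
  have h13 : κ.layer 1 ≤ κ.layer 3 := h12.trans h23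
  letI alg12 : Algebra (κ.layer 1) (κ.layer 2) := (IntermediateField.inclusion h12).toRingHom.toAlgebra
  letI alg23 : Algebra (κ.layer 2) (κ.layer 3) := (IntermediateField.inclusion h23).toRingHom.toAlgebra
  letI alg13 : Algebra (κ.layer 1) (κ.layer 3) := (IntermediateField.inclusion h13).toRingHom.toAlgebra
  haveI tow12 : IsScalarTower K (κ.layer 1) (κ.layer 2) :=
    IsScalarTower.of_algebraMap_eq fun x => ((IntermediateField.inclusion h12).commutes x).symm
  haveI tow23 : IsScalarTower K (κ.layer 2) (κ.layer 3) :=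
    IsScalarTower.of_algebraMap_eq fun x => ((IntermediateField.inclusion h23).commutes x).symm
  haveI tow13 : IsScalarTower K (κ.layer 1) (κ.layer 3) :=
    IsScalarTower.of_algebraMap_eq fun x => ((IntermediateField.inclusion h13).commutes x).symm
  haveI tow123 : IsScalarTower (κ.layer 1) (κ.layer 2) (κ.layer 3) :=
    IsScalarTower.of_algebraMap_eq fun x => (IntermediateField.inclusion_inclusion h12 h23 x).symm
  haveI : FiniteDimensional K (κ.layer 1) := κ.finiteDimensional_layer_holds 1
  haveI : FiniteDimensional K (κ.layer 2) := κ.finiteDimensional_layer_holds 2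
  haveI : FiniteDimensional K (κ.layer 3) := κ.finiteDimensional_layer_holds 3
  haveI : NumberField (κ.layer 1) := NumberField.of_module_finite K _
  haveI : NumberField (κ.layer 2) := NumberField.of_module_finite K _
  haveI : NumberField (κ.layer 3) := NumberField.of_module_finite K _
  haveI : IsGalois K (κ.layer 1) := κ.isGalois_layer_holds 1
  haveI : IsGalois K (κ.layer 2) := κ.isGalois_layer_holds 2
  haveI : IsGalois K (κ.layer 3) := κ.isGalois_layer_holds 3
  haveI : IsGalois (κ.layer 1) (κ.layer 2) := IsGalois.tower_top_of_isGalois K _ _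
  haveI : IsGalois (κ.layer 2) (κ.layer 3) := IsGalois.tower_top_of_isGalois K _ _
  haveI : IsGalois (κ.layer 1) (κ.layer 3) := IsGalois.tower_top_of_isGalois K _ _
  haveI : FiniteDimensional (κ.layer 1) (κ.layer 2) := Module.Finite.of_restrictScalars_finite K _ _
  haveI : FiniteDimensional (κ.layer 2) (κ.layer 3) := Module.Finite.of_restrictScalars_finite K _ _
  haveI : FiniteDimensional (κ.layer 1) (κ.layer 3) := Module.Finite.of_restrictScalars_finite K _ _
  have hdeg1 : Module.finrank K (κ.layer 1) = 2 := by rw [κ.finrank_layer_holds 1, pow_one]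
  have hdeg2 : Module.finrank (κ.layer 1) (κ.layer 2) = 2 := by
    letI : Algebra (κ.layer 1) (κ.layer (1 + 1)) := alg12
    haveI : IsScalarTower K (κ.layer 1) (κ.layer (1 + 1)) := tow12
    exact finrank_layer_one_layer_two κ
  have hdeg3 : Module.finrank (κ.layer 2) (κ.layer 3) = 2 := by
    letI : Algebra (κ.layer 2) (κ.layer (2 + 1)) := alg23
    haveI : IsScalarTower K (κ.layer 2) (κ.layer (2 + 1)) := tow23
    exact finrank_layer_two_layer_three κ
  have hdeg8 : Module.finrank K (κ.layer 3) = 8 := by rw [κ.finrank_layer_holds 3]; norm_num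
  -- ### generators `s₁ ∈ K₁`, `s₂ ∈ K₂`, `s₃ ∈ K₃` and their integral copies `S₁, S₂, S₃ ∈ 𝓞 K₃`
  obtain ⟨s₁, s₂, s₃, hs₁, hs₂, hs₃, hs₁K, hs₂K, hs₃K⟩ := exists_generators_three_layers hK2 hd κ hκ
  have hs₁int : IsIntegral ℤ s₁ := by
    refine ⟨Polynomial.X ^ 2 - Polynomial.C 2, Polynomial.monic_X_pow_sub_C _ two_ne_zero, ?_⟩
    simp [hs₁]
  have h2int₂ : IsIntegral ℤ (2 : κ.layer 2) := by
    have := isIntegral_algebraMap (R := ℤ) (A := κ.layer 2) (x := (2 : ℤ))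
    rwa [map_ofNat] at this
  have hs₂int : IsIntegral ℤ s₂ := by
    refine IsIntegral.of_pow (n := 2) (by norm_num) ?_
    rw [hs₂, map_add, map_ofNat]
    exact h2int₂.add (map_isIntegral_int _ hs₁int)
  have h2int : IsIntegral ℤ (2 : κ.layer 3) := by
    have := isIntegral_algebraMap (R := ℤ) (A := κ.layer 3) (x := (2 : ℤ))
    rwa [map_ofNat] at this
  have hs₃int : IsIntegral ℤ s₃ := by
    refine IsIntegral.of_pow (n := 2) (by norm_num) ?_
    rw [hs₃, map_add, map_ofNat]
    exact h2int.add (map_isIntegral_int _ hs₂int)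
  obtain ⟨S₁, hS₁val⟩ : ∃ S : 𝓞 (κ.layer 3), algebraMap (𝓞 (κ.layer 3)) (κ.layer 3) S = algebraMap (κ.layer 1) (κ.layer 3) s₁ :=
    ⟨⟨_, map_isIntegral_int (algebraMap (κ.layer 1) (κ.layer 3)) hs₁int⟩, rfl⟩
  obtain ⟨S₂, hS₂val⟩ : ∃ S : 𝓞 (κ.layer 3), algebraMap (𝓞 (κ.layer 3)) (κ.layer 3) S = algebraMap (κ.layer 2) (κ.layer 3) s₂ :=
    ⟨⟨_, map_isIntegral_int (algebraMap (κ.layer 2) (κ.layer 3)) hs₂int⟩, rfl⟩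
  obtain ⟨S₃, hS₃val⟩ : ∃ S : 𝓞 (κ.layer 3), algebraMap (𝓞 (κ.layer 3)) (κ.layer 3) S = s₃ := ⟨⟨_, hs₃int⟩, rfl⟩
  have h12L : ∀ x : κ.layer 1, algebraMap (κ.layer 2) (κ.layer 3) (algebraMap (κ.layer 1) (κ.layer 2) x) = algebraMap (κ.layer 1) (κ.layer 3) x := fun x =>
    (IsScalarTower.algebraMap_apply (κ.layer 1) (κ.layer 2) (κ.layer 3) x).symm
  have hS₁ : S₁ ^ 2 = 2 := by
    apply RingOfIntegers.coe_injective
    rw [map_pow, map_ofNat, hS₁val, ← map_pow, hs₁, map_ofNat]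
  have hS₂ : S₂ ^ 2 = 2 + S₁ := by
    apply RingOfIntegers.coe_injective
    rw [map_pow, map_add, map_ofNat, hS₂val, hS₁val, ← map_pow, hs₂, h12L, map_add, map_ofNat]
  have hS₃ : S₃ ^ 2 = 2 + S₂ := by
    apply RingOfIntegers.coe_injective
    rw [map_pow, map_add, map_ofNat, hS₃val, hS₂val, hs₃, map_add, map_ofNat]
  set f := algebraMap (𝓞 K) (𝓞 (κ.layer 3)) with hf
  have hcoe : ∀ z : 𝓞 K, algebraMap (𝓞 (κ.layer 3)) (κ.layer 3) (f z) = algebraMap K (κ.layer 3) (z : K) := fun z => by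
    rw [hf]
    exact (IsScalarTower.algebraMap_apply (𝓞 K) (𝓞 (κ.layer 3)) (κ.layer 3) z).symm.trans
      (IsScalarTower.algebraMap_apply (𝓞 K) K (κ.layer 3) z)
  have hia : ∀ (τ : (κ.layer 3) ≃ₐ[K] (κ.layer 3)) (x : 𝓞 (κ.layer 3)),
      algebraMap (𝓞 (κ.layer 3)) (κ.layer 3) ((intAut τ : 𝓞 (κ.layer 3) →+* 𝓞 (κ.layer 3)) x) = τ (algebraMap (𝓞 (κ.layer 3)) (κ.layer 3) x) :=
    fun τ x => rfl
  -- ### the generator `σ` of `Gal(K₃/K)` with `σ s₃ = s₃³ − 3 s₃`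
  obtain ⟨σ, hσ⟩ := exists_algEquiv_apply_eq_tower3 (K := K) hdeg1 hdeg2 hdeg3 hs₁ hs₁K hs₂ hs₂K hs₃ hs₃K
  have hgen : ∀ τ : (κ.layer 3) ≃ₐ[K] (κ.layer 3), τ ∈ Subgroup.zpowers σ :=
    forall_mem_zpowers_of_apply_eq_tower3 (K := K) hdeg1 hdeg2 hdeg3 hs₁ hs₁K hs₂ hs₂K hs₃ hσ
  obtain ⟨-, -, hσ1, hσ2, hσ3, hσ4, hσ5⟩ := tower3_galois_iterates (K := K) hs₁ hs₂ hs₃ hσ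
  -- ### the ideal `I₀ = (q₀, S₃ − t)` and its conjugates
  have hq₀0 : q₀ ≠ 0 := fun h0 => by
    rw [h0, Ideal.span_singleton_zero] at hq₀
    exact Ring.ne_bot_of_isMaximal_of_not_isField hq₀ (RingOfIntegers.not_isField K) rfl
  obtain ⟨b, hb⟩ : ∃ b : 𝓞 (κ.layer 3), b = f q₀ := ⟨_, rfl⟩
  have hbL : algebraMap (𝓞 (κ.layer 3)) (κ.layer 3) b = algebraMap K (κ.layer 3) (q₀ : K) := by rw [hb, hcoe]
  have hb0 : b ≠ 0 := fun h => hq₀0 (by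
    have h' : algebraMap (𝓞 (κ.layer 3)) (κ.layer 3) b = 0 := by rw [h, map_zero]
    rw [hbL, map_eq_zero_iff _ (algebraMap K (κ.layer 3)).injective] at h'
    exact RingOfIntegers.coe_injective (by simpa using h'))
  have hI0 : Ideal.span {b, S₃ - t} ≠ ⊥ := fun h => hb0 (by
    have : b ∈ Ideal.span {b, S₃ - (t : 𝓞 (κ.layer 3))} := Ideal.subset_span (by simp)
    rw [h, Ideal.mem_bot] at this
    exact this)
  -- `τ I₀ = (q₀, τ s₃ − t)`
  have hmapI : ∀ (τ : (κ.layer 3) ≃ₐ[K] (κ.layer 3)) (Z : 𝓞 (κ.layer 3)), algebraMap (𝓞 (κ.layer 3)) (κ.layer 3) Z = τ s₃ - t →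
      (Ideal.span {b, S₃ - (t : 𝓞 (κ.layer 3))}).map (intAut τ : 𝓞 (κ.layer 3) →+* 𝓞 (κ.layer 3)) = Ideal.span {b, Z} := by
    intro τ Z hZ
    rw [Ideal.map_span, Set.image_pair]
    have h1 : (intAut τ : 𝓞 (κ.layer 3) →+* 𝓞 (κ.layer 3)) b = b := by
      apply RingOfIntegers.coe_injective
      rw [hia, hbL]
      exact τ.commutes (q₀ : K)
    have h2 : (intAut τ : 𝓞 (κ.layer 3) →+* 𝓞 (κ.layer 3)) (S₃ - t) = Z := by
      apply RingOfIntegers.coe_injective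
      rw [hia, hZ, map_sub, map_intCast, hS₃val, map_sub, map_intCast]
    rw [h1, h2]
  have hσ0 : (σ ^ 0) s₃ = s₃ := by rw [pow_zero, AlgEquiv.one_apply]
  have hσ1' : (σ ^ 1) s₃ = algebraMap (κ.layer 2) (κ.layer 3) s₂ * s₃ - s₃ := by rw [pow_one, hσ1]
  have hσ6 : (σ ^ 6) s₃ = -s₃ - algebraMap (κ.layer 1) (κ.layer 3) s₁ * s₃ + algebraMap (κ.layer 1) (κ.layer 3) s₁ * algebraMap (κ.layer 2) (κ.layer 3) s₂ * s₃ := by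
    rw [show (6 : ℕ) = 2 + 4 from rfl, pow_add, AlgEquiv.mul_apply, hσ4, map_neg, hσ2]; ring
  have hσ7 : (σ ^ 7) s₃ = -s₃ - algebraMap (κ.layer 1) (κ.layer 3) s₁ * s₃ + algebraMap (κ.layer 2) (κ.layer 3) s₂ * s₃ := by
    rw [show (7 : ℕ) = 3 + 4 from rfl, pow_add, AlgEquiv.mul_apply, hσ4, map_neg, hσ3]; ring
  have hZ₀ : algebraMap (𝓞 (κ.layer 3)) (κ.layer 3) (S₃ - (t : 𝓞 (κ.layer 3))) = (σ ^ 0) s₃ - t := by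
    simp only [map_sub, map_intCast, hS₃val, hσ0]
  have hJ₀ : (Ideal.span {b, S₃ - (t : 𝓞 (κ.layer 3))}).map (intAut (σ ^ 0) : 𝓞 (κ.layer 3) →+* 𝓞 (κ.layer 3)) = Ideal.span {b, S₃ - (t : 𝓞 (κ.layer 3))} :=
    hmapI (σ ^ 0) _ hZ₀
  have hZ₁ : algebraMap (𝓞 (κ.layer 3)) (κ.layer 3) (S₂ * S₃ - S₃ - (t : 𝓞 (κ.layer 3))) = (σ ^ 1) s₃ - t := by
    simp only [map_sub, map_mul, map_intCast, hS₂val, hS₃val, hσ1']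
  have hJ₁ : (Ideal.span {b, S₃ - (t : 𝓞 (κ.layer 3))}).map (intAut (σ ^ 1) : 𝓞 (κ.layer 3) →+* 𝓞 (κ.layer 3)) = Ideal.span {b, S₂ * S₃ - S₃ - (t : 𝓞 (κ.layer 3))} :=
    hmapI (σ ^ 1) _ hZ₁
  have hZ₂ : algebraMap (𝓞 (κ.layer 3)) (κ.layer 3) (S₃ + S₁ * S₃ - S₁ * S₂ * S₃ - (t : 𝓞 (κ.layer 3))) = (σ ^ 2) s₃ - t := by
    simp only [map_sub, map_add, map_mul, map_intCast, hS₁val, hS₂val, hS₃val, hσ2]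
  have hJ₂ : (Ideal.span {b, S₃ - (t : 𝓞 (κ.layer 3))}).map (intAut (σ ^ 2) : 𝓞 (κ.layer 3) →+* 𝓞 (κ.layer 3)) = Ideal.span {b, S₃ + S₁ * S₃ - S₁ * S₂ * S₃ - (t : 𝓞 (κ.layer 3))} :=
    hmapI (σ ^ 2) _ hZ₂
  have hZ₃ : algebraMap (𝓞 (κ.layer 3)) (κ.layer 3) (S₃ + S₁ * S₃ - S₂ * S₃ - (t : 𝓞 (κ.layer 3))) = (σ ^ 3) s₃ - t := by
    simp only [map_sub, map_add, map_mul, map_intCast, hS₁val, hS₂val, hS₃val, hσ3]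
  have hJ₃ : (Ideal.span {b, S₃ - (t : 𝓞 (κ.layer 3))}).map (intAut (σ ^ 3) : 𝓞 (κ.layer 3) →+* 𝓞 (κ.layer 3)) = Ideal.span {b, S₃ + S₁ * S₃ - S₂ * S₃ - (t : 𝓞 (κ.layer 3))} :=
    hmapI (σ ^ 3) _ hZ₃
  have hZ₄ : algebraMap (𝓞 (κ.layer 3)) (κ.layer 3) (-S₃ - (t : 𝓞 (κ.layer 3))) = (σ ^ 4) s₃ - t := by
    simp only [map_sub, map_neg, map_intCast, hS₃val, hσ4]
  have hJ₄ : (Ideal.span {b, S₃ - (t : 𝓞 (κ.layer 3))}).map (intAut (σ ^ 4) : 𝓞 (κ.layer 3) →+* 𝓞 (κ.layer 3)) = Ideal.span {b, -S₃ - (t : 𝓞 (κ.layer 3))} :=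
    hmapI (σ ^ 4) _ hZ₄
  have hZ₅ : algebraMap (𝓞 (κ.layer 3)) (κ.layer 3) (S₃ - S₂ * S₃ - (t : 𝓞 (κ.layer 3))) = (σ ^ 5) s₃ - t := by
    simp only [map_sub, map_mul, map_intCast, hS₂val, hS₃val, hσ5]
  have hJ₅ : (Ideal.span {b, S₃ - (t : 𝓞 (κ.layer 3))}).map (intAut (σ ^ 5) : 𝓞 (κ.layer 3) →+* 𝓞 (κ.layer 3)) = Ideal.span {b, S₃ - S₂ * S₃ - (t : 𝓞 (κ.layer 3))} :=
    hmapI (σ ^ 5) _ hZ₅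
  have hZ₆ : algebraMap (𝓞 (κ.layer 3)) (κ.layer 3) (-S₃ - S₁ * S₃ + S₁ * S₂ * S₃ - (t : 𝓞 (κ.layer 3))) = (σ ^ 6) s₃ - t := by
    simp only [map_sub, map_add, map_neg, map_mul, map_intCast, hS₁val, hS₂val, hS₃val, hσ6]
  have hJ₆ : (Ideal.span {b, S₃ - (t : 𝓞 (κ.layer 3))}).map (intAut (σ ^ 6) : 𝓞 (κ.layer 3) →+* 𝓞 (κ.layer 3)) = Ideal.span {b, -S₃ - S₁ * S₃ + S₁ * S₂ * S₃ - (t : 𝓞 (κ.layer 3))} :=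
    hmapI (σ ^ 6) _ hZ₆
  have hZ₇ : algebraMap (𝓞 (κ.layer 3)) (κ.layer 3) (-S₃ - S₁ * S₃ + S₂ * S₃ - (t : 𝓞 (κ.layer 3))) = (σ ^ 7) s₃ - t := by
    simp only [map_sub, map_add, map_neg, map_mul, map_intCast, hS₁val, hS₂val, hS₃val, hσ7]
  have hJ₇ : (Ideal.span {b, S₃ - (t : 𝓞 (κ.layer 3))}).map (intAut (σ ^ 7) : 𝓞 (κ.layer 3) →+* 𝓞 (κ.layer 3)) = Ideal.span {b, -S₃ - S₁ * S₃ + S₂ * S₃ - (t : 𝓞 (κ.layer 3))} :=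
    hmapI (σ ^ 7) _ hZ₇
  have hcomax₁ : f α₁ * b + (-(f v₁) * ((-1) + S₂ + S₃ * (t : 𝓞 (κ.layer 3)) + (t : 𝓞 (κ.layer 3)) ^ 2)) * (S₃ - (t : 𝓞 (κ.layer 3))) + f v₁ * (S₂ * S₃ - S₃ - (t : 𝓞 (κ.layer 3))) = 1 := by
    have h := congrArg f hC₁
    simp only [map_add, map_mul, map_one, map_intCast, map_pow, map_neg, map_ofNat] at h
    rw [hb]
    linear_combination h + ((-1) * f v₁ * (t : 𝓞 (κ.layer 3))) * hS₃
  have hcomax₂ : f α₂ * b + (-(f v₂) * (1 + S₁ + (-1) * S₁ * S₂ + (-6) * S₃ * (t : 𝓞 (κ.layer 3)) + (-6) * (t : 𝓞 (κ.layer 3)) ^ 2 + (-1) * S₁ * S₃ * (t : 𝓞 (κ.layer 3)) + (-1) * S₁ * (t : 𝓞 (κ.layer 3)) ^ 2 + 3 * S₂ * S₃ * (t : 𝓞 (κ.layer 3)) + 3 * S₂ * (t : 𝓞 (κ.layer 3)) ^ 2 + 5 * S₃ * (t : 𝓞 (κ.layer 3)) ^ 3 + 5 * (t : 𝓞 (κ.layer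 3)) ^ 4 + (-1) * S₂ * S₃ * (t : 𝓞 (κ.layer 3)) ^ 3 + (-1) * S₂ * (t : 𝓞 (κ.layer 3)) ^ 4 + (-1) * S₃ * (t : 𝓞 (κ.layer 3)) ^ 5 + (-1) * (t : 𝓞 (κ.layer 3)) ^ 6)) * (S₃ - (t : 𝓞 (κ.layer 3))) + f v₂ * (S₃ + S₁ * S₃ - S₁ * S₂ * S₃ - (t : 𝓞 (κ.layer 3))) = 1 := by
    have h := congrArg f hC₂
    simp only [map_add, map_mul, map_one, map_intCast, map_pow, map_neg, map_ofNat] at h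
    rw [hb]
    linear_combination h + (6 * f v₂ * (t : 𝓞 (κ.layer 3)) + S₁ * f v₂ * (t : 𝓞 (κ.layer 3)) + (-3) * S₂ * f v₂ * (t : 𝓞 (κ.layer 3)) + (-5) * f v₂ * (t : 𝓞 (κ.layer 3)) ^ 3 + S₂ * f v₂ * (t : 𝓞 (κ.layer 3)) ^ 3 + f v₂ * (t : 𝓞 (κ.layer 3)) ^ 5) * hS₃ + ((-3) * f v₂ * (t : 𝓞 (κ.layer 3)) + f v₂ * (t : 𝓞 (κ.layer 3)) ^ 3) * hS₂
  have hcomax₃ : f α₃ * b + (-(f v₃) * (1 + S₁ + (-1) * S₂ + (-3) * S₃ * (t : 𝓞 (κ.layer 3)) + (-3) * (t : 𝓞 (κ.layer 3)) ^ 2 + S₂ * S₃ * (t : 𝓞 (κ.layer 3)) + S₂ * (t : 𝓞 (κ.layer 3)) ^ 2 + S₃ * (t : 𝓞 (κ.layer 3)) ^ 3 + (t : 𝓞 (κ.layer 3)) ^ 4)) * (S₃ - (t : 𝓞 (κ.layer 3))) + f v₃ * (S₃ + S₁ * S₃ - S₂ * S₃ - (t : 𝓞 (κ.layer 3))) = 1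 := by
    have h := congrArg f hC₃
    simp only [map_add, map_mul, map_one, map_intCast, map_pow, map_neg, map_ofNat] at h
    rw [hb]
    linear_combination h + (3 * f v₃ * (t : 𝓞 (κ.layer 3)) + (-1) * S₂ * f v₃ * (t : 𝓞 (κ.layer 3)) + (-1) * f v₃ * (t : 𝓞 (κ.layer 3)) ^ 3) * hS₃ + ((-1) * f v₃ * (t : 𝓞 (κ.layer 3))) * hS₂
  have hcomax₄ : f α₄ * b + (-(f v₄) * ((-1))) * (S₃ - (t : 𝓞 (κ.layer 3))) + f v₄ * (-S₃ - (t : 𝓞 (κ.layer 3))) = 1 := by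
    have h := congrArg f hC₄
    simp only [map_add, map_mul, map_one, map_intCast, map_neg, map_ofNat] at h
    rw [hb]
    linear_combination h
  have hcomax₅ : f α₅ * b + (-(f v₅) * (1 + (-1) * S₂ + (-1) * S₃ * (t : 𝓞 (κ.layer 3)) + (-1) * (t : 𝓞 (κ.layer 3)) ^ 2)) * (S₃ - (t : 𝓞 (κ.layer 3))) + f v₅ * (S₃ - S₂ * S₃ - (t : 𝓞 (κ.layer 3))) = 1 := by
    have h := congrArg f hC₅
    simp only [map_add, map_mul, map_one, map_intCast, map_pow, map_neg, map_ofNat] at h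
    rw [hb]
    linear_combination h + (f v₅ * (t : 𝓞 (κ.layer 3))) * hS₃
  have hcomax₆ : f α₆ * b + (-(f v₆) * ((-1) + (-1) * S₁ + S₁ * S₂ + 6 * S₃ * (t : 𝓞 (κ.layer 3)) + 6 * (t : 𝓞 (κ.layer 3)) ^ 2 + S₁ * S₃ * (t : 𝓞 (κ.layer 3)) + S₁ * (t : 𝓞 (κ.layer 3)) ^ 2 + (-3) * S₂ * S₃ * (t : 𝓞 (κ.layer 3)) + (-3) * S₂ * (t : 𝓞 (κ.layer 3)) ^ 2 + (-5) * S₃ * (t : 𝓞 (κ.layer 3)) ^ 3 + (-5) * (t : 𝓞 (κ.layer 3)) ^ 4 + S₂ * S₃ * (t : 𝓞 (κ.layer 3)) ^ 3 + S₂ * (t : 𝓞 (κ.layer 3)) ^ 4 + S₃ * (t : 𝓞 (κ.layer 3)) ^ 5 + (t : 𝓞 (κ.layer 3)) ^ 6)) * (S₃ - (t : 𝓞 (κ.layer 3))) + f v₆ * (-S₃ - S₁ * S₃ + S₁ * S₂ * S₃ - (t : 𝓞 (κ.layer 3))) = 1 := by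
    have h := congrArg f hC₆
    simp only [map_add, map_mul, map_one, map_intCast, map_pow, map_neg, map_ofNat] at h
    rw [hb]
    linear_combination h + ((-6) * f v₆ * (t : 𝓞 (κ.layer 3)) + (-1) * S₁ * f v₆ * (t : 𝓞 (κ.layer 3)) + 3 * S₂ * f v₆ * (t : 𝓞 (κ.layer 3)) + 5 * f v₆ * (t : 𝓞 (κ.layer 3)) ^ 3 + (-1) * S₂ * f v₆ * (t : 𝓞 (κ.layer 3)) ^ 3 + (-1) * f v₆ * (t : 𝓞 (κ.layer 3)) ^ 5) * hS₃ + (3 * f v₆ * (t : 𝓞 (κ.layer 3)) + (-1) * f v₆ * (t : 𝓞 (κ.layer 3)) ^ 3) * hS₂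
  have hcomax₇ : f α₇ * b + (-(f v₇) * ((-1) + (-1) * S₁ + S₂ + 3 * S₃ * (t : 𝓞 (κ.layer 3)) + 3 * (t : 𝓞 (κ.layer 3)) ^ 2 + (-1) * S₂ * S₃ * (t : 𝓞 (κ.layer 3)) + (-1) * S₂ * (t : 𝓞 (κ.layer 3)) ^ 2 + (-1) * S₃ * (t : 𝓞 (κ.layer 3)) ^ 3 + (-1) * (t : 𝓞 (κ.layer 3)) ^ 4)) * (S₃ - (t : 𝓞 (κ.layer 3))) + f v₇ * (-S₃ - S₁ * S₃ + S₂ * S₃ - (t : 𝓞 (κ.layer 3))) = 1 := by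
    have h := congrArg f hC₇
    simp only [map_add, map_mul, map_one, map_intCast, map_pow, map_neg, map_ofNat] at h
    rw [hb]
    linear_combination h + ((-3) * f v₇ * (t : 𝓞 (κ.layer 3)) + S₂ * f v₇ * (t : 𝓞 (κ.layer 3)) + f v₇ * (t : 𝓞 (κ.layer 3)) ^ 3) * hS₃ + (f v₇ * (t : 𝓞 (κ.layer 3))) * hS₂
  -- ### the eight conjugates are pairwise coprime
  have hcop : ∀ k, 0 < k → k < 8 →
      Ideal.span {b, S₃ - (t : 𝓞 (κ.layer 3))} ⊔ (Ideal.span {b, S₃ - (t : 𝓞 (κ.layer 3))}).map (intAut (σ ^ k) : 𝓞 (κ.layer 3) →+* 𝓞 (κ.layer 3)) = ⊤ := by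
    intro k hk0 hk8
    interval_cases k
    · rw [hJ₁]; exact span_pair_sup_span_pair_eq_top_of_comax hcomax₁
    · rw [hJ₂]; exact span_pair_sup_span_pair_eq_top_of_comax hcomax₂
    · rw [hJ₃]; exact span_pair_sup_span_pair_eq_top_of_comax hcomax₃
    · rw [hJ₄]; exact span_pair_sup_span_pair_eq_top_of_comax hcomax₄
    · rw [hJ₅]; exact span_pair_sup_span_pair_eq_top_of_comax hcomax₅
    · rw [hJ₆]; exact span_pair_sup_span_pair_eq_top_of_comax hcomax₆
    · rw [hJ₇]; exact span_pair_sup_span_pair_eq_top_of_comax hcomax₇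
  have hcomp : ∀ i k : ℕ, (intAut (σ ^ i) : 𝓞 (κ.layer 3) →+* 𝓞 (κ.layer 3)).comp (intAut (σ ^ k) : 𝓞 (κ.layer 3) →+* 𝓞 (κ.layer 3)) = (intAut (σ ^ (i + k)) : 𝓞 (κ.layer 3) →+* 𝓞 (κ.layer 3)) := by
    intro i k
    refine RingHom.ext fun x => RingOfIntegers.coe_injective ?_
    rw [RingHom.comp_apply, hia, hia, hia, ← AlgEquiv.mul_apply, ← pow_add]
  obtain ⟨e, he0, he1, he2, he3, he4, he5, he6, he7⟩ : ∃ e : ℕ → ℕ, e 0 = e₀ ∧ e 1 = e₁ ∧ e 2 = e₂ ∧ e 3 = e₃ ∧ e 4 = e₄ ∧ e 5 = e₅ ∧ e 6 = e₆ ∧ e 7 = e₇ :=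
    ⟨fun i => if i = 0 then e₀ else if i = 1 then e₁ else if i = 2 then e₂ else if i = 3 then e₃ else if i = 4 then e₄ else if i = 5 then e₅
      else if i = 6 then e₆ else if i = 7 then e₇ else 0, rfl, rfl, rfl, rfl, rfl, rfl, rfl, rfl⟩
  have hpair : ((Finset.range 8 : Finset ℕ) : Set ℕ).Pairwise
      (Function.onFun IsCoprime fun i => ((Ideal.span {b, S₃ - (t : 𝓞 (κ.layer 3))}).map (intAut (σ ^ i) : 𝓞 (κ.layer 3) →+* 𝓞 (κ.layer 3))) ^ e i) := by
    have key : ∀ i j : ℕ, i < j → j < 8 → IsCoprime (((Ideal.span {b, S₃ - (t : 𝓞 (κ.layer 3))}).map (intAut (σ ^ i) : 𝓞 (κ.layer 3) →+* 𝓞 (κ.layer 3))) ^ e i)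
        (((Ideal.span {b, S₃ - (t : 𝓞 (κ.layer 3))}).map (intAut (σ ^ j) : 𝓞 (κ.layer 3) →+* 𝓞 (κ.layer 3))) ^ e j) := by
      intro i j hij hj8
      rw [Ideal.isCoprime_iff_sup_eq]
      apply Ideal.pow_sup_pow_eq_top
      have h := congrArg (Ideal.map (intAut (σ ^ i) : 𝓞 (κ.layer 3) →+* 𝓞 (κ.layer 3))) (hcop (j - i) (by omega) (by omega))
      rw [Ideal.map_sup, Ideal.map_top, Ideal.map_map, hcomp i (j - i), show i + (j - i) = j by omega] at h
      exact h
    intro i hi j hj hij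
    rw [Finset.coe_range, Set.mem_Iio] at hi hj
    rcases Nat.lt_or_gt_of_ne hij with h | h
    · exact key i j h hj
    · exact (key j i h hi).symm
  -- ### `y ∈ σ^i(I₀)^(e i)` for every `i`, hence `y ∈ ⋂ = ∏`
  obtain ⟨Y, hYdef⟩ : ∃ Y : 𝓞 (κ.layer 3), Y = f y₀ + f y₁ * S₁ + (f y₂ + f y₃ * S₁) * S₂ + (f y₄ + f y₅ * S₁ + (f y₆ + f y₇ * S₁) * S₂) * S₃ := ⟨_, rfl⟩
  have hY₀ : Y ∈ ((Ideal.span {b, S₃ - (t : 𝓞 (κ.layer 3))}).map (intAut (σ ^ 0) : 𝓞 (κ.layer 3) →+* 𝓞 (κ.layer 3))) ^ e 0 := by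
    obtain ⟨c, hc⟩ := hmem₀ (𝓞 (κ.layer 3)) f S₁ S₂ S₃ hS₁ hS₂ hS₃
    rw [he0, hJ₀, hYdef, hc, hb]
    exact sum_mul_pow_mul_pow_mem_span_pair_pow _ _ _ _
  have hY₁ : Y ∈ ((Ideal.span {b, S₃ - (t : 𝓞 (κ.layer 3))}).map (intAut (σ ^ 1) : 𝓞 (κ.layer 3) →+* 𝓞 (κ.layer 3))) ^ e 1 := by
    obtain ⟨c, hc⟩ := hmem₁ (𝓞 (κ.layer 3)) f S₁ S₂ S₃ hS₁ hS₂ hS₃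
    rw [he1, hJ₁, hYdef, hc, hb]
    exact sum_mul_pow_mul_pow_mem_span_pair_pow _ _ _ _
  have hY₂ : Y ∈ ((Ideal.span {b, S₃ - (t : 𝓞 (κ.layer 3))}).map (intAut (σ ^ 2) : 𝓞 (κ.layer 3) →+* 𝓞 (κ.layer 3))) ^ e 2 := by
    obtain ⟨c, hc⟩ := hmem₂ (𝓞 (κ.layer 3)) f S₁ S₂ S₃ hS₁ hS₂ hS₃
    rw [he2, hJ₂, hYdef, hc, hb]
    exact sum_mul_pow_mul_pow_mem_span_pair_pow _ _ _ _
  have hY₃ : Y ∈ ((Ideal.span {b, S₃ - (t : 𝓞 (κ.layer 3))}).map (intAut (σ ^ 3) : 𝓞 (κ.layer 3) →+* 𝓞 (κ.layer 3))) ^ e 3 := by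
    obtain ⟨c, hc⟩ := hmem₃ (𝓞 (κ.layer 3)) f S₁ S₂ S₃ hS₁ hS₂ hS₃
    rw [he3, hJ₃, hYdef, hc, hb]
    exact sum_mul_pow_mul_pow_mem_span_pair_pow _ _ _ _
  have hY₄ : Y ∈ ((Ideal.span {b, S₃ - (t : 𝓞 (κ.layer 3))}).map (intAut (σ ^ 4) : 𝓞 (κ.layer 3) →+* 𝓞 (κ.layer 3))) ^ e 4 := by
    obtain ⟨c, hc⟩ := hmem₄ (𝓞 (κ.layer 3)) f S₁ S₂ S₃ hS₁ hS₂ hS₃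
    rw [he4, hJ₄, hYdef, hc, hb]
    exact sum_mul_pow_mul_pow_mem_span_pair_pow _ _ _ _
  have hY₅ : Y ∈ ((Ideal.span {b, S₃ - (t : 𝓞 (κ.layer 3))}).map (intAut (σ ^ 5) : 𝓞 (κ.layer 3) →+* 𝓞 (κ.layer 3))) ^ e 5 := by
    obtain ⟨c, hc⟩ := hmem₅ (𝓞 (κ.layer 3)) f S₁ S₂ S₃ hS₁ hS₂ hS₃
    rw [he5, hJ₅, hYdef, hc, hb]
    exact sum_mul_pow_mul_pow_mem_span_pair_pow _ _ _ _
  have hY₆ : Y ∈ ((Ideal.span {b, S₃ - (t : 𝓞 (κ.layer 3))}).map (intAut (σ ^ 6) : 𝓞 (κ.layer 3) →+* 𝓞 (κ.layer 3))) ^ e 6 := by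
    obtain ⟨c, hc⟩ := hmem₆ (𝓞 (κ.layer 3)) f S₁ S₂ S₃ hS₁ hS₂ hS₃
    rw [he6, hJ₆, hYdef, hc, hb]
    exact sum_mul_pow_mul_pow_mem_span_pair_pow _ _ _ _
  have hY₇ : Y ∈ ((Ideal.span {b, S₃ - (t : 𝓞 (κ.layer 3))}).map (intAut (σ ^ 7) : 𝓞 (κ.layer 3) →+* 𝓞 (κ.layer 3))) ^ e 7 := by
    obtain ⟨c, hc⟩ := hmem₇ (𝓞 (κ.layer 3)) f S₁ S₂ S₃ hS₁ hS₂ hS₃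
    rw [he7, hJ₇, hYdef, hc, hb]
    exact sum_mul_pow_mul_pow_mem_span_pair_pow _ _ _ _
  have hYinf : Y ∈ ⨅ i ∈ Finset.range 8, ((Ideal.span {b, S₃ - (t : 𝓞 (κ.layer 3))}).map (intAut (σ ^ i) : 𝓞 (κ.layer 3) →+* 𝓞 (κ.layer 3))) ^ e i := by
    refine (Submodule.mem_iInf _).mpr fun i => (Submodule.mem_iInf _).mpr fun hi => ?_
    rw [Finset.mem_range] at hi
    interval_cases i
    · exact hY₀
    · exact hY₁
    · exact hY₂
    · exact hY₃
    · exact hY₄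
    · exact hY₅
    · exact hY₆
    · exact hY₇
  have hYA : Y ∈ ∏ i ∈ Finset.range 8, ((Ideal.span {b, S₃ - (t : 𝓞 (κ.layer 3))}).map (intAut (σ ^ i) : 𝓞 (κ.layer 3) →+* 𝓞 (κ.layer 3))) ^ e i := by
    rw [Ideal.prod_eq_iInf_of_pairwise_isCoprime hpair]
    exact hYinf
  have hnormq : Algebra.intNorm (𝓞 K) (𝓞 (κ.layer 3)) b = q₀ ^ 8 := by
    apply RingOfIntegers.coe_injective
    rw [Algebra.algebraMap_intNorm (A := 𝓞 K) (K := K) (L := κ.layer 3) (B := 𝓞 (κ.layer 3)) b, hbL, Algebra.norm_algebraMap, hdeg8, map_pow]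
  have hnormz : Algebra.intNorm (𝓞 K) (𝓞 (κ.layer 3)) (S₃ - t) = (((t : 𝓞 K) ^ 2 - 2) ^ 2 - 2) ^ 2 - 2 := by
    apply RingOfIntegers.coe_injective
    rw [Algebra.algebraMap_intNorm (A := 𝓞 K) (K := K) (L := κ.layer 3) (B := 𝓞 (κ.layer 3)) (S₃ - t), map_sub, map_intCast, hS₃val]
    have hz : (s₃ - t : κ.layer 3) = algebraMap K (κ.layer 3) (-(t : K)) + algebraMap K (κ.layer 3) 0 * algebraMap (κ.layer 1) (κ.layer 3) s₁
        + (algebraMap K (κ.layer 3) 0 + algebraMap K (κ.layer 3) 0 * algebraMap (κ.layer 1) (κ.layer 3) s₁) * algebraMap (κ.layer 2) (κ.layer 3) s₂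
        + (algebraMap K (κ.layer 3) 1 + algebraMap K (κ.layer 3) 0 * algebraMap (κ.layer 1) (κ.layer 3) s₁
          + (algebraMap K (κ.layer 3) 0 + algebraMap K (κ.layer 3) 0 * algebraMap (κ.layer 1) (κ.layer 3) s₁) * algebraMap (κ.layer 2) (κ.layer 3) s₂) * s₃ := by
      simp only [map_neg, map_intCast, map_zero, map_one]; ring
    rw [hz, Algebra.norm_tower3_eq hdeg1 hdeg2 hdeg3 hs₁ hs₁K hs₂ hs₂K hs₃ hs₃K (-(t : K)) 0 0 0 1 0 0 0
      (U₀ := (t : K) ^ 2 - 2) (U₁ := 0) (U₂ := -1) (U₃ := 0) (V₀ := ((t : K) ^ 2 - 2) ^ 2 - 2) (V₁ := -1)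
      (by ring) (by ring) (by ring) (by ring) (by ring) (by ring)]
    simp only [map_sub, map_pow, map_intCast, map_ofNat]
    ring
  have hqmem : q₀ ∈ Ideal.relNorm (𝓞 K) (Ideal.span {b, S₃ - (t : 𝓞 (κ.layer 3))}) := by
    have h1 : Algebra.intNorm (𝓞 K) (𝓞 (κ.layer 3)) b ∈ Ideal.relNorm (𝓞 K) (Ideal.span {b, S₃ - (t : 𝓞 (κ.layer 3))}) :=
      Ideal.intNorm_mem_spanNorm (R := 𝓞 K) (Ideal.subset_span (by simp))
    have h2 : Algebra.intNorm (𝓞 K) (𝓞 (κ.layer 3)) (S₃ - t) ∈ Ideal.relNorm (𝓞 K) (Ideal.span {b, S₃ - (t : 𝓞 (κ.layer 3))}) :=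
      Ideal.intNorm_mem_spanNorm (R := 𝓞 K) (Ideal.subset_span (by simp))
    rw [hnormq] at h1
    rw [hnormz] at h2
    rw [← hBez]
    exact Ideal.add_mem _ (Ideal.mul_mem_left _ _ h1) (Ideal.mul_mem_left _ _ h2)
  have hI0top : Ideal.span {b, S₃ - (t : 𝓞 (κ.layer 3))} ≠ ⊤ := by
    rw [hb]
    exact span_pair_ne_top_of_residue_tower3 hdeg1 hdeg2 hdeg3 hs₁ hs₁K hs₂ hs₂K hs₃ hs₃K q₀ t hq ψ hψ hti hPt hS₃val
  have hNI₀ : Ideal.relNorm (𝓞 K) (Ideal.span {b, S₃ - (t : 𝓞 (κ.layer 3))}) = Ideal.span {q₀} := by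
    have hle : Ideal.span {q₀} ≤ Ideal.relNorm (𝓞 K) (Ideal.span {b, S₃ - (t : 𝓞 (κ.layer 3))}) := (Ideal.span_singleton_le_iff_mem _).mpr hqmem
    have hne : Ideal.relNorm (𝓞 K) (Ideal.span {b, S₃ - (t : 𝓞 (κ.layer 3))}) ≠ ⊤ := fun htop => hI0top (by
      have h := Ideal.relNorm_le_comap (𝓞 K) (Ideal.span {b, S₃ - (t : 𝓞 (κ.layer 3))})
      rw [htop, top_le_iff, Ideal.comap_eq_top_iff] at h
      exact h)
    exact (hq₀.eq_of_le hne hle).symm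
  have hnormy : Algebra.intNorm (𝓞 K) (𝓞 (κ.layer 3)) (f y₀ + f y₁ * S₁ + (f y₂ + f y₃ * S₁) * S₂ + (f y₄ + f y₅ * S₁ + (f y₆ + f y₇ * S₁) * S₂) * S₃) =
      ε * q₀ ^ n := by
    apply RingOfIntegers.coe_injective
    rw [Algebra.algebraMap_intNorm (A := 𝓞 K) (K := K) (L := κ.layer 3) (B := 𝓞 (κ.layer 3))]
    have hz : algebraMap (𝓞 (κ.layer 3)) (κ.layer 3) (f y₀ + f y₁ * S₁ + (f y₂ + f y₃ * S₁) * S₂ + (f y₄ + f y₅ * S₁ + (f y₆ + f y₇ * S₁) * S₂) * S₃) =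
        algebraMap K (κ.layer 3) (y₀ : K) + algebraMap K (κ.layer 3) (y₁ : K) * algebraMap (κ.layer 1) (κ.layer 3) s₁
        + (algebraMap K (κ.layer 3) (y₂ : K) + algebraMap K (κ.layer 3) (y₃ : K) * algebraMap (κ.layer 1) (κ.layer 3) s₁) * algebraMap (κ.layer 2) (κ.layer 3) s₂
        + (algebraMap K (κ.layer 3) (y₄ : K) + algebraMap K (κ.layer 3) (y₅ : K) * algebraMap (κ.layer 1) (κ.layer 3) s₁
          + (algebraMap K (κ.layer 3) (y₆ : K) + algebraMap K (κ.layer 3) (y₇ : K) * algebraMap (κ.layer 1) (κ.layer 3) s₁) * algebraMap (κ.layer 2) (κ.layer 3) s₂) * s₃ := by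
      simp only [map_add, map_mul, hcoe, hS₁val, hS₂val, hS₃val]
    have gU₀ := congrArg (algebraMap (𝓞 K) K) hU₀
    have gU₁ := congrArg (algebraMap (𝓞 K) K) hU₁
    have gU₂ := congrArg (algebraMap (𝓞 K) K) hU₂
    have gU₃ := congrArg (algebraMap (𝓞 K) K) hU₃
    have gV₀ := congrArg (algebraMap (𝓞 K) K) hV₀
    have gV₁ := congrArg (algebraMap (𝓞 K) K) hV₁
    have gN := congrArg (algebraMap (𝓞 K) K) hN
    simp only [map_add, map_sub, map_mul, map_pow, map_neg, map_ofNat] at gU₀ gU₁ gU₂ gU₃ gV₀ gV₁ gN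
    rw [hz, Algebra.norm_tower3_eq hdeg1 hdeg2 hdeg3 hs₁ hs₁K hs₂ hs₂K hs₃ hs₃K _ _ _ _ _ _ _ _ gU₀ gU₁ gU₂ gU₃ gV₀ gV₁]
    exact gN
  have hconj : ∀ τ : (κ.layer 3) ≃ₐ[K] (κ.layer 3),
      Ideal.relNorm (𝓞 K) ((Ideal.span {b, S₃ - (t : 𝓞 (κ.layer 3))}).map (intAut τ : 𝓞 (κ.layer 3) →+* 𝓞 (κ.layer 3))) = Ideal.span {q₀} := by
    intro τ
    have hpt : ∀ x : 𝓞 (κ.layer 3), (intAut τ : 𝓞 (κ.layer 3) →+* 𝓞 (κ.layer 3)) x = galRestrict (𝓞 K) K (κ.layer 3) (𝓞 (κ.layer 3)) τ x := by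
      intro x
      apply RingOfIntegers.coe_injective
      rw [hia, algebraMap_galRestrict_apply]
    have hm : (Ideal.span {b, S₃ - (t : 𝓞 (κ.layer 3))}).map (intAut τ : 𝓞 (κ.layer 3) →+* 𝓞 (κ.layer 3)) =
        (Ideal.span {b, S₃ - (t : 𝓞 (κ.layer 3))}).map (galRestrict (𝓞 K) K (κ.layer 3) (𝓞 (κ.layer 3)) τ) := by
      unfold Ideal.map
      congr 1
      ext z
      simp only [Set.mem_image, SetLike.mem_coe, hpt]
    rw [hm, Ideal.relNorm_map_algEquiv, hNI₀]
  have hsum : ∑ i ∈ Finset.range 8, e i = n := by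
    simp only [Finset.sum_range_succ, Finset.sum_range_zero, zero_add, he0, he1, he2, he3, he4, he5, he6, he7]
    exact hn
  have hrelNormA : Ideal.relNorm (𝓞 K) (∏ i ∈ Finset.range 8, ((Ideal.span {b, S₃ - (t : 𝓞 (κ.layer 3))}).map (intAut (σ ^ i) : 𝓞 (κ.layer 3) →+* 𝓞 (κ.layer 3))) ^ e i) =
      Ideal.span {q₀} ^ n := by
    rw [map_prod]
    simp_rw [map_pow, hconj]
    rw [Finset.prod_pow_eq_pow_sum, hsum]
  have hyA : Ideal.span {Y} = ∏ i ∈ Finset.range 8, ((Ideal.span {b, S₃ - (t : 𝓞 (κ.layer 3))}).map (intAut (σ ^ i) : 𝓞 (κ.layer 3) →+* 𝓞 (κ.layer 3))) ^ e i := by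
    have hle := (Ideal.span_singleton_le_iff_mem _).mpr hYA
    obtain ⟨C, hC⟩ := Ideal.dvd_iff_le.mpr hle
    have hNy : Ideal.relNorm (𝓞 K) (Ideal.span {Y}) = Ideal.span {q₀} ^ n := by
      rw [Ideal.relNorm_singleton, hYdef, hnormy, Ideal.span_singleton_pow]
      exact Ideal.span_singleton_eq_span_singleton.mpr ⟨ε⁻¹, by rw [mul_comm (ε : 𝓞 K) (q₀ ^ n), mul_assoc, Units.mul_inv, mul_one]⟩
    have hne : Ideal.span {q₀} ^ n ≠ 0 := pow_ne_zero _ (by rw [Ne, Ideal.zero_eq_bot, Ideal.span_singleton_eq_bot]; exact hq₀0)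
    have hNC : Ideal.relNorm (𝓞 K) C = ⊤ := by
      have h := congrArg (Ideal.relNorm (𝓞 K)) hC
      rw [map_mul, hNy, hrelNormA] at h
      have h' : Ideal.span {q₀} ^ n * Ideal.relNorm (𝓞 K) C = Ideal.span {q₀} ^ n * ⊤ := by rw [Ideal.mul_top]; exact h.symm
      exact mul_left_cancel₀ hne h'
    have hCtop : C = ⊤ := by
      by_contra hC'
      obtain ⟨M, hM, hCM⟩ := Ideal.exists_le_maximal C hC'
      have h := Ideal.relNorm_mono (𝓞 K) hCM
      rw [hNC, top_le_iff] at h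
      haveI := hM
      haveI : (M.under (𝓞 K)).IsMaximal := Ideal.IsMaximal.under (𝓞 K) M
      rw [Ideal.relNorm_eq_pow_of_isMaximal M (M.under (𝓞 K)), Ideal.pow_eq_top_iff] at h
      rcases h with h | h
      · exact (Ideal.IsMaximal.ne_top inferInstance) h
      · exact (Ideal.inertiaDeg_pos M (R := 𝓞 K)).ne' h
    rw [hC, hCtop, Ideal.mul_top]
  -- ### the relation and the door
  have hrel := prod_pow_mulEquiv_intAut_mk0_eq_one (F := K) σ hI0 hyA.symm
  have hA0 : Ideal.relNorm (𝓞 (κ.layer 1)) (Ideal.span {b, S₃ - (t : 𝓞 (κ.layer 3))}) ≠ ⊥ :=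
    (Ideal.relNorm_eq_bot_iff (R := 𝓞 (κ.layer 1))).not.mpr hI0
  have hA : Ideal.relNorm (𝓞 K) (Ideal.relNorm (𝓞 (κ.layer 1)) (Ideal.span {b, S₃ - (t : 𝓞 (κ.layer 3))})) ^ 1 = Ideal.span {q₀} := by
    rw [pow_one, Ideal.relNorm_relNorm, hNI₀]
  have hcA : classGroupNorm (κ.layer 1) (κ.layer 3) (ClassGroup.mk0 ⟨Ideal.span {b, S₃ - (t : 𝓞 (κ.layer 3))}, mem_nonZeroDivisors_of_ne_zero hI0⟩) =
      ClassGroup.mk0 ⟨Ideal.relNorm (𝓞 (κ.layer 1)) (Ideal.span {b, S₃ - (t : 𝓞 (κ.layer 3))}), mem_nonZeroDivisors_of_ne_zero hA0⟩ :=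
    classGroupNorm_mk0 (κ.layer 1) ⟨_, mem_nonZeroDivisors_of_ne_zero hI0⟩
  have hF' : (∑ i ∈ Finset.range 8, C ((e i : ℕ) : ℤ) * X ^ i : ℤ[X]) = (X - 1) ^ d * u + C (2 : ℤ) * g := by
    simp only [Finset.sum_range_succ, Finset.sum_range_zero, zero_add, pow_zero, mul_one, pow_one, he0, he1, he2, he3, he4, he5, he6, he7]
    exact hF
  exact classicalMuVanishes_two_of_relation_of_genusCert_layer_anyDepth hK2 hd κ hκ h2card hh (m := 3) (by norm_num) P hres h2P hunits hπ hA0 hA σ hgen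
    hcA (N := 8) (d := d) (show d + 2 ≤ 2 ^ 3 by norm_num; omega) hu hF' hrel

end Layer

end Literature.NumberTheory.IwasawaTheory

end
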